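import Summits.Ventures.PercRepro.C041FourExitMain
import Summits.Ventures.PercRepro.C041FiveExitMain

/-!
# ROW C-041 — THE FOUR- AND FIVE-EXIT BLOCK MAPS, by name (p6, gen 32; the summary module of the r = 4 and r = 5
chains)

The two end theorems restated with all their hypotheses in the type, for the referees' tree read: THEOREM (FOUR-EXIT
BLOCK MAP) (`row_C041_four_exit_block_map`, `sixVec_glue4`: 52 status patterns, the case tree unpruned) and THEOREM
(FIVE-EXIT BLOCK MAP) (`row_C041_five_exit_block_map`, `sixVec_glue5`: 203 status patterns, the case tree pruned).
Together with `sixVec_glue2` / `sixVec_glue3` this is C-041.md §20 (c) for every `r ≤ 5`.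
-/

namespace PercRepro

namespace ZoneZ

open ZoneData TreeClosure TwoExit

/-- **THEOREM (FOUR-EXIT BLOCK MAP)**: the six-vector of an unmarked multigraph `Z₁` with 4 zones hung at the exits
`u, u', u'', u'''`, at the anchor `a₁`, is the sum over the
colourings of `Z₁` of the contribution of the statuses of the 4 exits (merged / reached per exit, blue-connected
per pair). -/
theorem row_C041_four_exit_block_map {V₁ E₁ U₁ U₂ V E T₁ T₂ V' E' T₁' T₂' V'' E'' T₁'' T₂'' V''' E''' T₁''' T₂''' : Type}
    (Z₁ : ZoneData V₁ E₁ U₁ U₂) (u u' u'' u''' : V₁) (Z : ZoneData V E T₁ T₂) (a : V)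
    (Z' : ZoneData V' E' T₁' T₂') (a' : V') (Z'' : ZoneData V'' E'' T₁'' T₂'') (a'' : V'')
    (Z''' : ZoneData V''' E''' T₁''' T₂''') (a''' : V''')
    (a₁ : V₁) [Fintype E₁] [DecidableEq E₁] [Fintype E] [DecidableEq E] [Fintype T₁] [DecidableEq T₁]
    [Fintype T₂] [DecidableEq T₂] [Fintype E'] [DecidableEq E'] [Fintype T₁'] [DecidableEq T₁'] [Fintype T₂']
    [DecidableEq T₂'] [Fintype E''] [DecidableEq E''] [Fintype T₁''] [DecidableEq T₁''] [Fintype T₂'']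
    [DecidableEq T₂''] [Fintype E'''] [DecidableEq E'''] [Fintype T₁'''] [DecidableEq T₁'''] [Fintype T₂''']
    [DecidableEq T₂'''] :
    (glue4 Z₁ u u' u'' u''' Z a Z' a' Z'' a'' Z''' a''').sixVec (Sum.inl (Sum.inl (Sum.inl (Sum.inl a₁)))) =
      ∑ ω : E₁ → Bool, contrib4 (Z.sixVec a) (Z'.sixVec a') (Z''.sixVec a'') (Z'''.sixVec a''') (Z₁.Mg a₁ u ω)
    (Z₁.Rd a₁ u ω) (Z₁.Mg a₁ u' ω) (Z₁.Rd a₁ u' ω) (Z₁.Mg a₁ u'' ω) (Z₁.Rd a₁ u'' ω) (Z₁.Mg a₁ u''' ω)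
    (Z₁.Rd a₁ u''' ω) (Z₁.Mg u u' ω) (Z₁.Mg u'' u ω) (Z₁.Mg u''' u ω) (Z₁.Mg u'' u' ω) (Z₁.Mg u''' u' ω)
    (Z₁.Mg u''' u'' ω) :=
  sixVec_glue4 Z₁ u u' u'' u''' Z a Z' a' Z'' a'' Z''' a''' a₁

set_option synthInstance.maxSize 2048 in
/-- **THEOREM (FIVE-EXIT BLOCK MAP)**: the six-vector of an unmarked multigraph `Z₁` with 5 zones hung at the exits
`u, u', u'', u''', u''''`, at the anchor `a₁`, is the sum over the
colourings of `Z₁` of the contribution of the statuses of the 5 exits (merged / reached per exit, blue-connected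
per pair). -/
theorem row_C041_five_exit_block_map {V₁ E₁ U₁ U₂ V E T₁ T₂ V' E' T₁' T₂' V'' E'' T₁'' T₂'' V''' E''' T₁''' T₂''' V'''' E'''' T₁'''' T₂'''' : Type}
    (Z₁ : ZoneData V₁ E₁ U₁ U₂) (u u' u'' u''' u'''' : V₁) (Z : ZoneData V E T₁ T₂) (a : V)
    (Z' : ZoneData V' E' T₁' T₂') (a' : V') (Z'' : ZoneData V'' E'' T₁'' T₂'') (a'' : V'')
    (Z''' : ZoneData V''' E''' T₁''' T₂''') (a''' : V''') (Z'''' : ZoneData V'''' E'''' T₁'''' T₂'''')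
    (a'''' : V'''')
    (a₁ : V₁) [Fintype E₁] [DecidableEq E₁] [Fintype E] [DecidableEq E] [Fintype T₁] [DecidableEq T₁]
    [Fintype T₂] [DecidableEq T₂] [Fintype E'] [DecidableEq E'] [Fintype T₁'] [DecidableEq T₁'] [Fintype T₂']
    [DecidableEq T₂'] [Fintype E''] [DecidableEq E''] [Fintype T₁''] [DecidableEq T₁''] [Fintype T₂'']
    [DecidableEq T₂''] [Fintype E'''] [DecidableEq E'''] [Fintype T₁'''] [DecidableEq T₁'''] [Fintype T₂''']
    [DecidableEq T₂'''] [Fintype E''''] [DecidableEq E''''] [Fintype T₁''''] [DecidableEq T₁'''']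
    [Fintype T₂''''] [DecidableEq T₂''''] :
    (glue5 Z₁ u u' u'' u''' u'''' Z a Z' a' Z'' a'' Z''' a''' Z'''' a'''').sixVec (Sum.inl (Sum.inl (Sum.inl (Sum.inl (Sum.inl a₁))))) =
      ∑ ω : E₁ → Bool, contrib5 (Z.sixVec a) (Z'.sixVec a') (Z''.sixVec a'') (Z'''.sixVec a''')
    (Z''''.sixVec a'''') (Z₁.Mg a₁ u ω) (Z₁.Rd a₁ u ω) (Z₁.Mg a₁ u' ω) (Z₁.Rd a₁ u' ω) (Z₁.Mg a₁ u'' ω)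
    (Z₁.Rd a₁ u'' ω) (Z₁.Mg a₁ u''' ω) (Z₁.Rd a₁ u''' ω) (Z₁.Mg a₁ u'''' ω) (Z₁.Rd a₁ u'''' ω) (Z₁.Mg u u' ω)
    (Z₁.Mg u'' u ω) (Z₁.Mg u''' u ω) (Z₁.Mg u'''' u ω) (Z₁.Mg u'' u' ω) (Z₁.Mg u''' u' ω) (Z₁.Mg u'''' u' ω)
    (Z₁.Mg u''' u'' ω) (Z₁.Mg u'''' u'' ω) (Z₁.Mg u'''' u''' ω) :=
  sixVec_glue5 Z₁ u u' u'' u''' u'''' Z a Z' a' Z'' a'' Z''' a''' Z'''' a'''' a₁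

end ZoneZ

end PercRepro
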